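import Literature.Analysis.FluidPDE.MVSliceIntegrability
import HarnessLib

/-!
# The measure-valued identities tested with the strong solution, in averaged form (BF (3.4)–(3.5))

Let `(Y, D)` be a dissipative measure-valued solution carried by the open quadrant
(`DissipativeMVEuler.IsDissipativeMVSolution`) and `(ρ, u, ϑ)` a classical solution on
`[0,T₁) ⊃ [0,T]`. With global `C¹` extensions `ψ₁, ψ₂, ψ₃` of BF's test functions
`φ₁ = ½|u|² - μ(ρ,ϑ)`, `u`, `ϑ` beyond `[0,T']` (`TestTriple`, from
`Torus.exists_contDiff_one_extension`), the continuity identity (2.20), the momentum identity (2.21)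
and the entropy inequality (2.22) take, for a.e. `τ ∈ (0,T)`, the averaged forms

* `cont_identity_avg`:  `[∫⟨Y;ρ⟩ψ₁]₀^τ = ∫_{(0,τ)×𝕋³} ⟨Y_z; contI(d_z)⟩ dz`,
* `mom_identity_avg`:   `[∫⟨Y;m⟩·ψ₂]₀^τ = ∫_{(0,τ)×𝕋³} ⟨Y_z; momI(d_z)⟩ dz + ∫∇ψ₂ : dμ_R`,
* `ent_inequality_avg`: `∫_{(0,τ)×𝕋³} ⟨Y_z; entI_Z(d_z)⟩ dz ≤ [∫⟨Y;ρZ(s)⟩ψ₃]₀^τ`,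

where `d_z` is the point data of the strong solution (`pdAt`) and `contI, momI, entI` are the
integrands of `MVRelativeEnergyIntegrands.lean`.

## References

* J. Březina, E. Feireisl, J. Math. Soc. Japan 70 (2018), (2.20)–(2.22), (3.4)–(3.5).
-/

noncomputable section

open Set Function MeasureTheory ProbabilityTheory Filter
open scoped BigOperators ENNReal Topology InnerProductSpace

namespace Literature.Analysis.FluidPDE

namespace CompressibleEuler

open Literature.Analysis.FunctionSpaces Literature.Analysis.FunctionSpaces.Torus EulerPhase
  StrongPointData EulerEOS

variable {eos : EulerEOS} {T T₁ : ℝ} {ρ : ℝ → UnitAddTorus (Fin 3) → ℝ}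
  {u : ℝ → UnitAddTorus (Fin 3) → EuclideanSpace ℝ (Fin 3)} {ϑ : ℝ → UnitAddTorus (Fin 3) → ℝ}
  {Y : Kernel (ℝ × UnitAddTorus (Fin 3)) EulerPhase} {D : ℝ → ℝ}

/-! ## Small algebra of brackets -/

/-- The real inner product on `ℝ³` in coordinates (second argument first, to match the integrands).
[folklore] -/
theorem inner_eq_sum' (a b : EuclideanSpace ℝ (Fin 3)) : ⟪a, b⟫_ℝ = ∑ i, b i * a i := by
  rw [PiLp.inner_apply]
  refine Finset.sum_congr rfl fun i _ => ?_
  simp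

/-- `toConservative.pressure ρ E = p(ρ, ϑ(ρ,E))`. [folklore] -/
theorem toConservative_pressure (eos : EulerEOS) (r E : ℝ) :
    eos.toConservative.pressure r E = eos.p r (stateTemp eos r E) := rfl

/-- `toConservative.entropy ρ E = s(ρ, ϑ(ρ,E))`. [folklore] -/
theorem toConservative_entropy (eos : EulerEOS) (r E : ℝ) :
    eos.toConservative.entropy r E = eos.s r (stateTemp eos r E) := rfl

/-! ## Basic integrability for a.e. fibre -/

/-- For a.e. `z ∈ (0,T) × 𝕋³`, all basic functions of the state are `Y_z`-integrable.
[cite: BrezinaFeireisl2018, (2.8)–(2.11)] -/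
theorem ae_integrable_basic (hG : eos.IsGibbs) (hS : eos.IsThermodynamicallyStable)
    (htemp : ∀ r E : ℝ, 0 < r → 0 < E →
      0 < eos.temperature r E ∧ r * eos.e r (eos.temperature r E) = E)
    (hMV : IsDissipativeMVSolution eos.toConservative T Y D)
    (hsupp : ∀ z, ∀ᵐ w ∂(Y z), w ∈ phaseQuadrant) {Z : ℝ → ℝ} (hZc : Continuous Z) {Zb : ℝ}
    (hZb : ∀ x, |Z x| ≤ Zb) :
    ∀ᵐ z ∂((volume : Measure (ℝ × UnitAddTorus (Fin 3))).restrict (Ioo 0 T ×ˢ univ)),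
      Integrable (dens : EulerPhase → ℝ) (Y z) ∧
      Integrable (mom : EulerPhase → EuclideanSpace ℝ (Fin 3)) (Y z) ∧
      (∀ i, Integrable (fun w : EulerPhase => mom w i) (Y z)) ∧
      Integrable (fun w : EulerPhase => eos.p (dens w) (stateTemp eos (dens w) (ien w))) (Y z) ∧
      (∀ i j, Integrable (fun w : EulerPhase => mom w i * mom w j / dens w) (Y z)) ∧
      Integrable (fun w : EulerPhase => dens w * Z (eos.s (dens w) (stateTemp eos (dens w) (ien w)))) (Y z) ∧
      Integrable (fun w : EulerPhase =>
        Z (eos.s (dens w) (stateTemp eos (dens w) (ien w))) • mom w) (Y z) := by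
  haveI := hMV.markov
  filter_upwards [ae_moment_lt_top hG hS htemp hMV hsupp] with z hz
  obtain ⟨-, hd, hm, hmi, -, -, hp, hmm, hρZ, hZm⟩ :=
    integrable_basic_of_moment hG hS htemp (μ := Y z) (hsupp z) hz.ne hZc hZb
  exact ⟨hd, hm, hmi, hp, hmm, hρZ, hZm⟩

/-! ## The continuity identity in averaged form -/

/-- **Continuity identity (2.20) tested with `ψ₁`**, right-hand side in bracket form.
[cite: BrezinaFeireisl2018, (2.20), (3.4)] -/
theorem cont_identity_avg (hG : eos.IsGibbs) (hS : eos.IsThermodynamicallyStable)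
    (htemp : ∀ r E : ℝ, 0 < r → 0 < E →
      0 < eos.temperature r E ∧ r * eos.e r (eos.temperature r E) = E)
    (h : IsClassicalEulerSolution eos T₁ ρ u ϑ)
    (hMV : IsDissipativeMVSolution eos.toConservative T Y D)
    (hsupp : ∀ z, ∀ᵐ w ∂(Y z), w ∈ phaseQuadrant) (Ψ : TestTriple eos T T₁ ρ u ϑ) :
    ∀ᵐ τ ∂(volume.restrict (Ioo 0 T)),
      (∫ x, Young.avg Y dens τ x * Ψ.ψ₁ τ x) - ∫ x, Young.avg Y dens 0 x * Ψ.ψ₁ 0 x =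
        ∫ z in Ioo 0 τ ×ˢ univ, ∫ w, (pdAt T₁ ρ u ϑ z).contI eos w ∂(Y z) := by
  have hc := hMV.continuity Ψ.ψ₁ Ψ.hψ₁
  have hb := ae_integrable_basic hG hS htemp hMV hsupp (Z := fun _ => (0 : ℝ)) continuous_const
    (Zb := 0) (fun _ => by simp)
  rw [ae_restrict_iff' (measurableSet_Ioo.prod MeasurableSet.univ)] at hb
  filter_upwards [hc, ae_restrict_mem measurableSet_Ioo] with τ hτ hτT
  rw [hτ]
  refine setIntegral_congr_ae (measurableSet_Ioo.prod MeasurableSet.univ) ?_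
  filter_upwards [hb] with z hz hzτ
  have hzT : z ∈ Ioo (0 : ℝ) T ×ˢ (univ : Set (UnitAddTorus (Fin 3))) :=
    ⟨⟨hzτ.1.1, hzτ.1.2.trans hτT.2⟩, mem_univ _⟩
  obtain ⟨hd, hm, hmi, -, -, -, -⟩ := hz hzT
  have ht' : z.1 ∈ Ioo 0 Ψ.T' := ⟨hzτ.1.1, (hzτ.1.2.trans hτT.2).trans Ψ.hT⟩
  have ht₁ : z.1 ∈ Ico 0 T₁ := ⟨hzτ.1.1.le, (ht'.2).trans Ψ.hT'⟩
  -- rewrite the test-function derivatives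
  rw [Ψ.timeDeriv_ψ₁ h hG ht' z.2]
  have hgrad : Torus.gradient (Ψ.ψ₁ z.1) z.2 =
      WithLp.toLp 2 fun j => (pdAt T₁ ρ u ϑ (z.1, z.2)).gφ₁ eos j := by
    ext j
    rw [Ψ.gradient_ψ₁ h hG ⟨ht'.1.le, ht'.2.le⟩ ht₁ z.2 j]
  rw [hgrad]
  -- brackets
  simp only [Young.avg, Young.vavg, Prod.mk.eta]
  rw [real_inner_comm, ← integral_inner hm, ← integral_mul_const]
  rw [← integral_add (hd.mul_const _) ?_]
  · refine integral_congr_ae (Eventually.of_forall fun w => ?_)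
    simp only [contI, inner_eq_sum']
  · have : (fun w : EulerPhase => ⟪(WithLp.toLp 2 fun j => (pdAt T₁ ρ u ϑ (z.1, z.2)).gφ₁ eos j), mom w⟫_ℝ) =
        fun w => ∑ i, mom w i * (pdAt T₁ ρ u ϑ (z.1, z.2)).gφ₁ eos i := by
      funext w; rw [inner_eq_sum']
    rw [this]
    exact integrable_finsetSum _ fun i _ => (hmi i).mul_const _

/-! ## The momentum identity in averaged form -/

/-- **Momentum identity (2.21) tested with `ψ₂`**, right-hand side in bracket form.
[cite: BrezinaFeireisl2018, (2.21), (3.4)] -/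
theorem mom_identity_avg (hG : eos.IsGibbs) (hS : eos.IsThermodynamicallyStable)
    (htemp : ∀ r E : ℝ, 0 < r → 0 < E →
      0 < eos.temperature r E ∧ r * eos.e r (eos.temperature r E) = E)
    (hMV : IsDissipativeMVSolution eos.toConservative T Y D)
    (hsupp : ∀ z, ∀ᵐ w ∂(Y z), w ∈ phaseQuadrant) (Ψ : TestTriple eos T T₁ ρ u ϑ)
    {μR : ConcentrationMeasure}
    (hmomid : ∀ φ : ℝ → UnitAddTorus (Fin 3) → EuclideanSpace ℝ (Fin 3), IsVectorTestFunction φ →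
      ∀ᵐ τ ∂(volume.restrict (Ioo 0 T)),
      (∫ x, inner ℝ (Young.vavg Y mom τ x) (φ τ x)) - ∫ x, inner ℝ (Young.vavg Y mom 0 x) (φ 0 x) =
        (∫ z in Ioo 0 τ ×ˢ univ, (inner ℝ (Young.vavg Y mom z.1 z.2) (Torus.timeDeriv φ z.1 z.2) +
          (∑ i, ∑ j, Young.avg Y (fun w => mom w i * mom w j / dens w) z.1 z.2 *
            Torus.partialDeriv j (fun y => φ z.1 y i) z.2) +
          Young.avg Y (fun w => eos.toConservative.pressure (dens w) (ien w)) z.1 z.2 *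
            Torus.divergence (φ z.1) z.2)) +
        μR.pairGrad τ φ) :
    ∀ᵐ τ ∂(volume.restrict (Ioo 0 T)),
      (∫ x, inner ℝ (Young.vavg Y mom τ x) (Ψ.ψ₂ τ x)) - ∫ x, inner ℝ (Young.vavg Y mom 0 x) (Ψ.ψ₂ 0 x) =
        (∫ z in Ioo 0 τ ×ˢ univ, ∫ w, (pdAt T₁ ρ u ϑ z).momI eos w ∂(Y z)) + μR.pairGrad τ Ψ.ψ₂ := by
  have hc := hmomid Ψ.ψ₂ Ψ.hψ₂
  have hb := ae_integrable_basic hG hS htemp hMV hsupp (Z := fun _ => (0 : ℝ)) continuous_const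
    (Zb := 0) (fun _ => by simp)
  rw [ae_restrict_iff' (measurableSet_Ioo.prod MeasurableSet.univ)] at hb
  filter_upwards [hc, ae_restrict_mem measurableSet_Ioo] with τ hτ hτT
  rw [hτ]
  congr 1
  refine setIntegral_congr_ae (measurableSet_Ioo.prod MeasurableSet.univ) ?_
  filter_upwards [hb] with z hz hzτ
  have hzT : z ∈ Ioo (0 : ℝ) T ×ˢ (univ : Set (UnitAddTorus (Fin 3))) :=
    ⟨⟨hzτ.1.1, hzτ.1.2.trans hτT.2⟩, mem_univ _⟩
  obtain ⟨-, hm, hmi, hp, hmm, -, -⟩ := hz hzT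
  have ht' : z.1 ∈ Ioo 0 Ψ.T' := ⟨hzτ.1.1, (hzτ.1.2.trans hτT.2).trans Ψ.hT⟩
  have htc : z.1 ∈ Icc 0 Ψ.T' := ⟨ht'.1.le, ht'.2.le⟩
  -- rewrite the test-function derivatives
  have e1 : Torus.timeDeriv Ψ.ψ₂ z.1 z.2 = (pdAt T₁ ρ u ϑ z).Ut := Ψ.timeDeriv_ψ₂ ht' z.2
  have e2 : ∀ i j, Torus.partialDeriv j (fun y => Ψ.ψ₂ z.1 y i) z.2 = (pdAt T₁ ρ u ϑ z).gU i j :=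
    fun i j => (Ψ.partialDeriv_ψ₂ htc z.2 i j).1
  have e3 : Torus.divergence (Ψ.ψ₂ z.1) z.2 = (pdAt T₁ ρ u ϑ z).divU := (Ψ.partialDeriv_ψ₂ htc z.2 0 0).2
  rw [e1, e3]
  simp only [e2, Young.avg, Young.vavg, Prod.mk.eta, toConservative_pressure]
  rw [real_inner_comm, ← integral_inner hm, ← integral_mul_const]
  have e4 : ∀ i j, (∫ w, mom w i * mom w j / dens w ∂(Y z)) * (pdAt T₁ ρ u ϑ z).gU i j =
      ∫ w, mom w i * mom w j / dens w * (pdAt T₁ ρ u ϑ z).gU i j ∂(Y z) :=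
    fun i j => (integral_mul_const _ _).symm
  simp only [e4]
  have e5 : ∀ i, ∑ j, ∫ w, mom w i * mom w j / dens w * (pdAt T₁ ρ u ϑ z).gU i j ∂(Y z) =
      ∫ w, ∑ j, mom w i * mom w j / dens w * (pdAt T₁ ρ u ϑ z).gU i j ∂(Y z) :=
    fun i => (integral_finsetSum _ fun j _ => (hmm i j).mul_const _).symm
  simp only [e5]
  rw [← integral_finsetSum _ fun i _ => integrable_finsetSum _ fun j _ => (hmm i j).mul_const _]
  have hI1 : Integrable (fun w : EulerPhase => ⟪(pdAt T₁ ρ u ϑ z).Ut, mom w⟫_ℝ) (Y z) := by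
    have : (fun w : EulerPhase => ⟪(pdAt T₁ ρ u ϑ z).Ut, mom w⟫_ℝ) =
        fun w => ∑ i, mom w i * (pdAt T₁ ρ u ϑ z).Ut i := by
      funext w; rw [inner_eq_sum']
    rw [this]
    exact integrable_finsetSum _ fun i _ => (hmi i).mul_const _
  have hI2 : Integrable (fun w : EulerPhase =>
      ∑ i, ∑ j, mom w i * mom w j / dens w * (pdAt T₁ ρ u ϑ z).gU i j) (Y z) :=
    integrable_finsetSum _ fun i _ => integrable_finsetSum _ fun j _ => (hmm i j).mul_const _
  have step1 : ∫ w, (⟪(pdAt T₁ ρ u ϑ z).Ut, mom w⟫_ℝ +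
      ∑ i, ∑ j, mom w i * mom w j / dens w * (pdAt T₁ ρ u ϑ z).gU i j) ∂(Y z) =
      (∫ w, ⟪(pdAt T₁ ρ u ϑ z).Ut, mom w⟫_ℝ ∂(Y z)) +
        ∫ w, ∑ i, ∑ j, mom w i * mom w j / dens w * (pdAt T₁ ρ u ϑ z).gU i j ∂(Y z) :=
    integral_add hI1 hI2
  have step2 : ∫ w, ((⟪(pdAt T₁ ρ u ϑ z).Ut, mom w⟫_ℝ +
      ∑ i, ∑ j, mom w i * mom w j / dens w * (pdAt T₁ ρ u ϑ z).gU i j) +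
      eos.p (dens w) (stateTemp eos (dens w) (ien w)) * (pdAt T₁ ρ u ϑ z).divU) ∂(Y z) =
      (∫ w, (⟪(pdAt T₁ ρ u ϑ z).Ut, mom w⟫_ℝ +
        ∑ i, ∑ j, mom w i * mom w j / dens w * (pdAt T₁ ρ u ϑ z).gU i j) ∂(Y z)) +
        ∫ w, eos.p (dens w) (stateTemp eos (dens w) (ien w)) * (pdAt T₁ ρ u ϑ z).divU ∂(Y z) :=
    integral_add (hI1.add hI2) (hp.mul_const _)
  rw [← step1, ← step2]
  refine integral_congr_ae (Eventually.of_forall fun w => ?_)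
  simp only [momI, inner_eq_sum']

/-! ## The entropy inequality in averaged form -/

/-- **Entropy inequality (2.22) tested with `ψ₃ ≥ 0` and a cut-off `Z`**, left-hand side in
bracket form. [cite: BrezinaFeireisl2018, (2.22), (3.4)] -/
theorem ent_inequality_avg (hG : eos.IsGibbs) (hS : eos.IsThermodynamicallyStable)
    (htemp : ∀ r E : ℝ, 0 < r → 0 < E →
      0 < eos.temperature r E ∧ r * eos.e r (eos.temperature r E) = E)
    (h : IsClassicalEulerSolution eos T₁ ρ u ϑ)
    (hMV : IsDissipativeMVSolution eos.toConservative T Y D)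
    (hsupp : ∀ z, ∀ᵐ w ∂(Y z), w ∈ phaseQuadrant) (Ψ : TestTriple eos T T₁ ρ u ϑ) (hT : T < T₁)
    {Z : ℝ → ℝ} (hZ : IsEntropyCutoff Z) :
    ∀ᵐ τ ∂(volume.restrict (Ioo 0 T)),
      (∫ z in Ioo 0 τ ×ˢ univ, ∫ w, (pdAt T₁ ρ u ϑ z).entI eos Z w ∂(Y z)) ≤
        (∫ x, Young.avg Y (fun w => dens w * Z (eos.toConservative.entropy (dens w) (ien w))) τ x *
            Ψ.ψ₃ τ x) -
          ∫ x, Young.avg Y (fun w => dens w * Z (eos.toConservative.entropy (dens w) (ien w))) 0 x *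
            Ψ.ψ₃ 0 x := by
  obtain ⟨Zb, hZb⟩ := hZ.2.2
  have hZc : Continuous Z := hZ.1
  have hpos : ∀ t ∈ Icc 0 T, ∀ x, 0 ≤ Ψ.ψ₃ t x := by
    intro t ht x
    rw [Ψ.eq₃ t ⟨ht.1, ht.2.trans Ψ.hT.le⟩ x]
    exact (h.temperature_pos t ⟨ht.1, lt_of_le_of_lt ht.2 hT⟩ x).le
  have hc := hMV.entropy Ψ.ψ₃ Ψ.hψ₃ hpos Z hZ
  have hb := ae_integrable_basic hG hS htemp hMV hsupp hZc hZb
  rw [ae_restrict_iff' (measurableSet_Ioo.prod MeasurableSet.univ)] at hb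
  filter_upwards [hc, ae_restrict_mem measurableSet_Ioo] with τ hτ hτT
  refine le_of_eq_of_le ?_ hτ
  refine setIntegral_congr_ae (measurableSet_Ioo.prod MeasurableSet.univ) ?_
  filter_upwards [hb] with z hz hzτ
  have hzT : z ∈ Ioo (0 : ℝ) T ×ˢ (univ : Set (UnitAddTorus (Fin 3))) :=
    ⟨⟨hzτ.1.1, hzτ.1.2.trans hτT.2⟩, mem_univ _⟩
  obtain ⟨-, -, hmi, -, -, hρZ, hZm⟩ := hz hzT
  have ht' : z.1 ∈ Ioo 0 Ψ.T' := ⟨hzτ.1.1, (hzτ.1.2.trans hτT.2).trans Ψ.hT⟩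
  have htc : z.1 ∈ Icc 0 Ψ.T' := ⟨ht'.1.le, ht'.2.le⟩
  have e1 : Torus.timeDeriv Ψ.ψ₃ z.1 z.2 = (pdAt T₁ ρ u ϑ z).Θt := Ψ.timeDeriv_ψ₃ ht' z.2
  have hgrad : Torus.gradient (Ψ.ψ₃ z.1) z.2 = WithLp.toLp 2 fun j => (pdAt T₁ ρ u ϑ z).gΘ j := by
    ext j
    rw [Ψ.gradient_ψ₃ htc z.2 j]
  rw [e1, hgrad]
  simp only [Young.avg, Young.vavg, Prod.mk.eta, toConservative_entropy]
  rw [real_inner_comm, ← integral_inner hZm, ← integral_mul_const]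
  have hI2 : Integrable (fun w : EulerPhase => ⟪(WithLp.toLp 2 fun j => (pdAt T₁ ρ u ϑ z).gΘ j),
      Z (eos.s (dens w) (stateTemp eos (dens w) (ien w))) • mom w⟫_ℝ) (Y z) := by
    have : (fun w : EulerPhase => ⟪(WithLp.toLp 2 fun j => (pdAt T₁ ρ u ϑ z).gΘ j),
        Z (eos.s (dens w) (stateTemp eos (dens w) (ien w))) • mom w⟫_ℝ) =
        fun w => ∑ i, (Z (eos.s (dens w) (stateTemp eos (dens w) (ien w))) • mom w) i *
          (pdAt T₁ ρ u ϑ z).gΘ i := by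
      funext w; rw [inner_eq_sum']
    rw [this]
    refine integrable_finsetSum _ fun i _ => Integrable.mul_const ?_ _
    have : (fun w : EulerPhase => (Z (eos.s (dens w) (stateTemp eos (dens w) (ien w))) • mom w) i) =
        fun w => (EuclideanSpace.proj i : EuclideanSpace ℝ (Fin 3) →L[ℝ] ℝ)
          (Z (eos.s (dens w) (stateTemp eos (dens w) (ien w))) • mom w) := by
      funext w; rfl
    rw [this]
    exact ContinuousLinearMap.integrable_comp _ hZm
  rw [← integral_add (hρZ.mul_const _) hI2]
  refine (integral_congr_ae (Eventually.of_forall fun w => ?_)).symm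
  simp only [entI, inner_eq_sum', PiLp.smul_apply, smul_eq_mul]

end CompressibleEuler

end Literature.Analysis.FluidPDE

/-!
# Time slices of the relative energy (Březina–Feireisl 2018, §3.1.1)

Deterministic and slice-wise ingredients of the relative-energy inequality:

* `pressure_ftc` — `∫_𝕋³ p(r,Θ)(τ) - ∫_𝕋³ p(r,Θ)(0) = ∫_{(0,τ)×𝕋³} ∂ₜp(r,Θ)` (FTC in time + Fubini);
* `relEnergyZ_slice_eq` — at a time where the slice moment bound holds,
  `∫⟨Y_{τ,x}; ℰ_Z(d)⟩ dx = ∫⟨Y;½|m|²/ρ+E⟩ - ∫⟨Y;m⟩·U + ∫⟨Y;ρ⟩φ₁ - ∫Θ⟨Y;ρZ(s)⟩ + ∫p(r,Θ)`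
  (the left-hand sides of the four DMV identities, BF (3.4));
* `relEnergyZ_classicalState`, `initial_terms_eq_zero` — at `τ = 0` with Dirac data the same
  combination vanishes;
* `abs_pairGrad_le` — `|∫∇ψ₂ : dμ_R| ≤ 9 M · massUpTo τ` when `|∂ⱼ(ψ₂)ᵢ| ≤ M` on `[0,τ) × 𝕋³`.

## References

* J. Březina, E. Feireisl, J. Math. Soc. Japan 70 (2018), (3.4)–(3.5), (2.29).
-/

noncomputable section

open Set Function MeasureTheory ProbabilityTheory Filter
open scoped BigOperators ENNReal Topology InnerProductSpace

namespace Literature.Analysis.FluidPDE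

namespace CompressibleEuler

open Literature.Analysis.FunctionSpaces EulerPhase StrongPointData EulerEOS
open Literature.Analysis.FunctionSpaces.Torus hiding kineticEnergy

variable {eos : EulerEOS} {T T₁ : ℝ} {ρ : ℝ → UnitAddTorus (Fin 3) → ℝ}
  {u : ℝ → UnitAddTorus (Fin 3) → EuclideanSpace ℝ (Fin 3)} {ϑ : ℝ → UnitAddTorus (Fin 3) → ℝ}
  {Y : Kernel (ℝ × UnitAddTorus (Fin 3)) EulerPhase} {D : ℝ → ℝ}

/-! ## Time slices of jointly smooth fields -/

/-- A field jointly continuous on `S × 𝕋ᵈ` (through the lift) has continuous time slices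
`s ↦ u s x` on `S`. [folklore] -/
theorem continuousOn_timeSlice {F : Type*} [TopologicalSpace F] {d : Type*} [Fintype d] {S : Set ℝ}
    {w : ℝ → UnitAddTorus d → F} (hw : ContinuousOn (stLift w) (S ×ˢ univ)) (x : UnitAddTorus d) :
    ContinuousOn (fun s => w s x) S := by
  obtain ⟨y, rfl⟩ := proj_surjective x
  exact hw.comp (continuousOn_id.prodMk continuousOn_const) fun s hs => mk_mem_prod hs (mem_univ _)

/-! ## The pressure of the strong solution: FTC in time -/

/-- Time derivative of `p(ρ, ϑ)` along the strong solution: `∂ₜ p(r,Θ) = p_ρ ∂ₜr + p_ϑ ∂ₜΘ`.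
[folklore] -/
theorem IsClassicalEulerSolution.hasDerivWithinAt_pressure (h : IsClassicalEulerSolution eos T₁ ρ u ϑ)
    (hG : eos.IsGibbs) {s : ℝ} (hs : s ∈ Ico 0 T₁) (x : UnitAddTorus (Fin 3)) :
    HasDerivWithinAt (fun σ => eos.p (ρ σ x) (ϑ σ x)) ((pdAt T₁ ρ u ϑ (s, x)).pt eos) (Ico 0 T₁) s := by
  have hpos : (ρ s x, ϑ s x) ∈ Ioi (0 : ℝ) ×ˢ Ioi (0 : ℝ) := ⟨h.density_pos s hs x, h.temperature_pos s hs x⟩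
  exact hasDerivWithinAt_comp₂ hG.1 isOpen_quadrant le_rfl hpos
    (h.smooth_density.hasDerivWithinAt_slice hs x) (h.smooth_temperature.hasDerivWithinAt_slice hs x)

/-- `s ↦ ∂ₜp(r,Θ)(s, x)` is continuous on `[0,T₁)`. [folklore] -/
theorem IsClassicalEulerSolution.continuousOn_pt_timeSlice (h : IsClassicalEulerSolution eos T₁ ρ u ϑ)
    (hG : eos.IsGibbs) (x : UnitAddTorus (Fin 3)) :
    ContinuousOn (fun s => (pdAt T₁ ρ u ϑ (s, x)).pt eos) (Ico 0 T₁) := by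
  have hS := uniqueDiffOn_Ico_time T₁
  have cr := continuousOn_timeSlice h.smooth_density.continuousOn_stLift x
  have cΘ := continuousOn_timeSlice h.smooth_temperature.continuousOn_stLift x
  have crt := continuousOn_timeSlice (h.smooth_density.timeDerivWithin hS).continuousOn_stLift x
  have cΘt := continuousOn_timeSlice (h.smooth_temperature.timeDerivWithin hS).continuousOn_stLift x
  have hpair := cr.prodMk cΘ
  have hmaps : MapsTo (fun s => (ρ s x, ϑ s x)) (Ico (0 : ℝ) T₁) (Ioi 0 ×ˢ Ioi 0) := fun s hs =>
    ⟨h.density_pos s hs x, h.temperature_pos s hs x⟩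
  have cpρ := (continuousOn_deriv_slice_fst hG.1 isOpen_quadrant le_rfl).comp hpair hmaps
  have cpϑ := (continuousOn_deriv_slice_snd hG.1 isOpen_quadrant le_rfl).comp hpair hmaps
  simp only [pt, pρ, pϑ]
  exact (cpρ.mul crt).add (cpϑ.mul cΘt)

/-- **FTC for the pressure of the strong solution, integrated over the torus**:
`∫ p(r,Θ)(τ,·) - ∫ p(r,Θ)(0,·) = ∫_{(0,τ)×𝕋³} ∂ₜp(r,Θ)`, for `0 < τ < T₁`, given a bound
`|∂ₜp(r,Θ)| ≤ N` on `[0,τ] × 𝕋³`. [cite: BrezinaFeireisl2018, (3.5)] -/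
theorem pressure_ftc (h : IsClassicalEulerSolution eos T₁ ρ u ϑ) (hG : eos.IsGibbs) {τ : ℝ}
    (hτ : τ ∈ Ioo 0 T₁) {N : ℝ} (hN : ∀ t ∈ Icc 0 τ, ∀ x, |(pdAt T₁ ρ u ϑ (t, x)).pt eos| ≤ N) :
    (∫ x, eos.p (ρ τ x) (ϑ τ x)) - ∫ x, eos.p (ρ 0 x) (ϑ 0 x) =
      ∫ z in Ioo 0 τ ×ˢ univ, (pdAt T₁ ρ u ϑ z).pt eos := by
  have hτ0 : (0 : ℝ) ≤ τ := hτ.1.le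
  have hsub : Icc (0 : ℝ) τ ⊆ Ico 0 T₁ := fun t ht => ⟨ht.1, lt_of_le_of_lt ht.2 hτ.2⟩
  -- pointwise FTC
  have hftc : ∀ x, eos.p (ρ τ x) (ϑ τ x) - eos.p (ρ 0 x) (ϑ 0 x) =
      ∫ s in (0 : ℝ)..τ, (pdAt T₁ ρ u ϑ (s, x)).pt eos := by
    intro x
    have hc : ContinuousOn (fun σ => eos.p (ρ σ x) (ϑ σ x)) (Icc 0 τ) := fun s hs =>
      ((h.hasDerivWithinAt_pressure hG (hsub hs) x).continuousWithinAt).mono hsub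
    have hd : ∀ s ∈ Ioo (0 : ℝ) τ, HasDerivWithinAt (fun σ => eos.p (ρ σ x) (ϑ σ x))
        ((pdAt T₁ ρ u ϑ (s, x)).pt eos) (Ioi s) s := fun s hs =>
      ((h.hasDerivWithinAt_pressure hG (hsub ⟨hs.1.le, hs.2.le⟩) x).hasDerivAt
        (Ico_mem_nhds hs.1 (hs.2.trans hτ.2))).hasDerivWithinAt
    have hi : IntervalIntegrable (fun s => (pdAt T₁ ρ u ϑ (s, x)).pt eos) volume 0 τ :=
      ((h.continuousOn_pt_timeSlice hG x).mono hsub).intervalIntegrable_of_Icc hτ0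
    exact (intervalIntegral.integral_eq_sub_of_hasDeriv_right_of_le hτ0 hc hd hi).symm
  -- integrability in `x` at fixed times
  have hslice : ∀ t ∈ Ico (0 : ℝ) T₁, Integrable (fun x => eos.p (ρ t x) (ϑ t x)) volume := by
    intro t ht
    obtain ⟨hρ1, hϑ1, -, -⟩ := h.isContDiff_slices ht
    have hpos : ∀ y, (ρ t y, ϑ t y) ∈ Ioi (0 : ℝ) ×ˢ Ioi (0 : ℝ) := fun y =>
      ⟨h.density_pos t ht y, h.temperature_pos t ht y⟩
    exact (isContDiff_comp₂ hG.1 le_rfl hρ1 hϑ1 hpos).continuous.integrable_of_hasCompactSupport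
      (HasCompactSupport.of_compactSpace _)
  -- joint integrability of `∂ₜp` on `(0,τ) × 𝕋³`
  set g : ℝ × UnitAddTorus (Fin 3) → ℝ := fun z => (pdAt T₁ ρ u ϑ z).pt eos with hg
  have hgc : ContinuousOn g (Ioo 0 T₁ ×ˢ univ) := (h.continuousOn_coeffs hG).2.2.1
  have hmeasS : MeasurableSet (Ioo (0 : ℝ) τ ×ˢ (univ : Set (UnitAddTorus (Fin 3)))) :=
    measurableSet_Ioo.prod MeasurableSet.univ
  have hSsub : Ioo (0 : ℝ) τ ×ˢ (univ : Set (UnitAddTorus (Fin 3))) ⊆ Ioo 0 T₁ ×ˢ univ :=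
    prod_mono (Ioo_subset_Ioo_right hτ.2.le) subset_rfl
  have hint : IntegrableOn g (Ioo 0 τ ×ˢ univ) (volume : Measure (ℝ × UnitAddTorus (Fin 3))) := by
    refine IntegrableOn.of_bound ?_ ((hgc.mono hSsub).aestronglyMeasurable hmeasS) N ?_
    · rw [Measure.volume_eq_prod, Measure.prod_prod]
      exact ENNReal.mul_lt_top measure_Ioo_lt_top (measure_lt_top _ _)
    · rw [ae_restrict_iff' hmeasS]
      exact Eventually.of_forall fun z hz => by
        rw [Real.norm_eq_abs]
        have := hN z.1 ⟨hz.1.1.le, hz.1.2.le⟩ z.2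
        exact this
  -- assemble
  rw [← integral_sub (hslice τ ⟨hτ0, hτ.2⟩) (hslice 0 ⟨le_rfl, hτ.1.trans hτ.2⟩)]
  simp_rw [hftc, intervalIntegral.integral_of_le hτ0]
  rw [Measure.volume_eq_prod, setIntegral_prod g hint]
  simp only [Measure.restrict_univ]
  rw [← integral_Ioc_eq_integral_Ioo]
  have hint' : Integrable (uncurry fun (s : ℝ) (x : UnitAddTorus (Fin 3)) => g (s, x))
      ((volume.restrict (Ioc (0 : ℝ) τ)).prod volume) := by
    rw [Measure.restrict_prod_eq_prod_univ]
    have : (uncurry fun (s : ℝ) (x : UnitAddTorus (Fin 3)) => g (s, x)) = g := by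
      funext z; rfl
    rw [this]
    have hint2 : IntegrableOn g (Ioc 0 τ ×ˢ univ) (volume : Measure (ℝ × UnitAddTorus (Fin 3))) := by
      refine hint.congr_set_ae ?_
      rw [Measure.volume_eq_prod]
      exact Measure.set_prod_ae_eq (Ioo_ae_eq_Ioc (a := (0 : ℝ)) (b := τ)).symm (ae_eq_refl _)
    rw [Measure.volume_eq_prod] at hint2
    exact hint2
  exact (integral_integral_swap hint').symm

/-! ## The relative energy at a good time, in terms of the DMV identities' left-hand sides -/

/-- On one fibre: `⟨ν; ℰ_Z(d)⟩ = ⟨ν;½|m|²/ρ+E⟩ - ⟨ν;m⟩·U + ⟨ν;ρ⟩φ₁ - Θ⟨ν;ρZ(s)⟩ + p(r,Θ)` for a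
probability measure `ν` making the basic functions integrable. [cite: BrezinaFeireisl2018, (3.4)] -/
theorem integral_relEnergyZ_eq {ν : Measure EulerPhase} [IsProbabilityMeasure ν] (Z : ℝ → ℝ)
    (d : StrongPointData)
    (hkin : Integrable (kineticEnergy : EulerPhase → ℝ) ν) (hien : Integrable (ien : EulerPhase → ℝ) ν)
    (hdens : Integrable (dens : EulerPhase → ℝ) ν)
    (hmom : Integrable (mom : EulerPhase → EuclideanSpace ℝ (Fin 3)) ν)
    (hmi : ∀ i, Integrable (fun w : EulerPhase => mom w i) ν)
    (hρZ : Integrable (fun w : EulerPhase => dens w * Z (eos.s (dens w) (stateTemp eos (dens w) (ien w)))) ν) :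
    ∫ w, d.relEnergyZ eos Z w ∂ν =
      (∫ w, kineticEnergy w + ien w ∂ν) - ⟪∫ w, mom w ∂ν, d.U⟫_ℝ +
        (∫ w, dens w ∂ν) * (‖d.U‖ ^ 2 / 2 - eos.chemPotential d.r d.Θ) -
          (∫ w, dens w * Z (eos.s (dens w) (stateTemp eos (dens w) (ien w))) ∂ν) * d.Θ +
            eos.p d.r d.Θ := by
  rw [real_inner_comm, ← integral_inner hmom, ← integral_mul_const, ← integral_mul_const]
  have hI2 : Integrable (fun w : EulerPhase => ⟪d.U, mom w⟫_ℝ) ν := by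
    have : (fun w : EulerPhase => ⟪d.U, mom w⟫_ℝ) = fun w => ∑ i, mom w i * d.U i := by
      funext w; rw [inner_eq_sum']
    rw [this]; exact integrable_finsetSum _ fun i _ => (hmi i).mul_const _
  have hI1 := hkin.add hien
  have hI3 := hdens.mul_const (‖d.U‖ ^ 2 / 2 - eos.chemPotential d.r d.Θ)
  have hI4 := hρZ.mul_const d.Θ
  have s1 : ∫ w, ((kineticEnergy w + ien w) - ⟪d.U, mom w⟫_ℝ) ∂ν =
      (∫ w, kineticEnergy w + ien w ∂ν) - ∫ w, ⟪d.U, mom w⟫_ℝ ∂ν := integral_sub hI1 hI2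
  have s2 : ∫ w, (((kineticEnergy w + ien w) - ⟪d.U, mom w⟫_ℝ) +
      dens w * (‖d.U‖ ^ 2 / 2 - eos.chemPotential d.r d.Θ)) ∂ν =
      (∫ w, ((kineticEnergy w + ien w) - ⟪d.U, mom w⟫_ℝ) ∂ν) +
        ∫ w, dens w * (‖d.U‖ ^ 2 / 2 - eos.chemPotential d.r d.Θ) ∂ν := integral_add (hI1.sub hI2) hI3
  have s3 : ∫ w, ((((kineticEnergy w + ien w) - ⟪d.U, mom w⟫_ℝ) +
      dens w * (‖d.U‖ ^ 2 / 2 - eos.chemPotential d.r d.Θ)) -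
      dens w * Z (eos.s (dens w) (stateTemp eos (dens w) (ien w))) * d.Θ) ∂ν =
      (∫ w, (((kineticEnergy w + ien w) - ⟪d.U, mom w⟫_ℝ) +
        dens w * (‖d.U‖ ^ 2 / 2 - eos.chemPotential d.r d.Θ)) ∂ν) -
        ∫ w, dens w * Z (eos.s (dens w) (stateTemp eos (dens w) (ien w))) * d.Θ ∂ν :=
    integral_sub ((hI1.sub hI2).add hI3) hI4
  have s4 : ∫ w, (((((kineticEnergy w + ien w) - ⟪d.U, mom w⟫_ℝ) +
      dens w * (‖d.U‖ ^ 2 / 2 - eos.chemPotential d.r d.Θ)) -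
      dens w * Z (eos.s (dens w) (stateTemp eos (dens w) (ien w))) * d.Θ) + eos.p d.r d.Θ) ∂ν =
      (∫ w, ((((kineticEnergy w + ien w) - ⟪d.U, mom w⟫_ℝ) +
        dens w * (‖d.U‖ ^ 2 / 2 - eos.chemPotential d.r d.Θ)) -
        dens w * Z (eos.s (dens w) (stateTemp eos (dens w) (ien w))) * d.Θ) ∂ν) +
        ∫ _w, eos.p d.r d.Θ ∂ν := integral_add (((hI1.sub hI2).add hI3).sub hI4) (integrable_const _)
  have s5 : ∫ _w : EulerPhase, eos.p d.r d.Θ ∂ν = eos.p d.r d.Θ := by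
    simp [integral_const]
  rw [← s1, ← s2, ← s3, ← s5, ← s4]
  refine integral_congr_ae (Eventually.of_forall fun w => ?_)
  simp only [relEnergyZ, inner_eq_sum']
  ring

/-- **The relative energy at a good time.** At `τ ∈ (0,T₁)` where the slice moment bound holds,
`∫⟨Y_{τ,x}; ℰ_Z(d(τ,x))⟩ dx` equals the signed combination of the left-hand sides of the energy
balance, the momentum identity (tested with `u`), the continuity identity (tested with `φ₁`), the
entropy inequality (tested with `ϑ`) and `∫ p(r,Θ)`, with all five `x`-integrands integrable.
[cite: BrezinaFeireisl2018, (3.4)] -/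
theorem relEnergyZ_slice_eq (hG : eos.IsGibbs) (hS : eos.IsThermodynamicallyStable)
    (htemp : ∀ r E : ℝ, 0 < r → 0 < E →
      0 < eos.temperature r E ∧ r * eos.e r (eos.temperature r E) = E)
    (h : IsClassicalEulerSolution eos T₁ ρ u ϑ) [IsMarkovKernel Y]
    (hsupp : ∀ z, ∀ᵐ w ∂(Y z), w ∈ phaseQuadrant) {τ : ℝ} (hτ : τ ∈ Ioo 0 T₁)
    {C : ℝ≥0∞} (hC : C < ∞)
    (hmom : ∫⁻ x, ∫⁻ w, ENNReal.ofReal (momentFun eos.toConservative w) ∂(Y (τ, x)) ≤ C)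
    {Z : ℝ → ℝ} (hZ : IsEntropyCutoff Z) {M : ℝ} (hB : ∀ x, (pdAt T₁ ρ u ϑ (τ, x)).Bounded M)
    {N : ℝ} (hN : ∀ x, |‖(pdAt T₁ ρ u ϑ (τ, x)).U‖ ^ 2 / 2 -
        eos.chemPotential (pdAt T₁ ρ u ϑ (τ, x)).r (pdAt T₁ ρ u ϑ (τ, x)).Θ| ≤ N ∧
      |eos.p (pdAt T₁ ρ u ϑ (τ, x)).r (pdAt T₁ ρ u ϑ (τ, x)).Θ| ≤ N ∧ |(pdAt T₁ ρ u ϑ (τ, x)).Θ| ≤ N) :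
    Integrable (fun x => ∫ w, (pdAt T₁ ρ u ϑ (τ, x)).relEnergyZ eos Z w ∂(Y (τ, x))) volume ∧
    Integrable (fun x => Young.avg Y (fun w => kineticEnergy w + ien w) τ x) volume ∧
    Integrable (fun x => ⟪Young.vavg Y mom τ x, u τ x⟫_ℝ) volume ∧
    Integrable (fun x => Young.avg Y dens τ x * energyTestFunction eos ρ u ϑ τ x) volume ∧
    Integrable (fun x => Young.avg Y (fun w => dens w * Z (eos.toConservative.entropy (dens w) (ien w))) τ x *
      ϑ τ x) volume ∧
    Integrable (fun x => eos.p (ρ τ x) (ϑ τ x)) volume ∧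
    ∫ x, ∫ w, (pdAt T₁ ρ u ϑ (τ, x)).relEnergyZ eos Z w ∂(Y (τ, x)) =
      (∫ x, Young.avg Y (fun w => kineticEnergy w + ien w) τ x) -
        (∫ x, ⟪Young.vavg Y mom τ x, u τ x⟫_ℝ) +
        (∫ x, Young.avg Y dens τ x * energyTestFunction eos ρ u ϑ τ x) -
        (∫ x, Young.avg Y (fun w => dens w * Z (eos.toConservative.entropy (dens w) (ien w))) τ x *
          ϑ τ x) +
        ∫ x, eos.p (ρ τ x) (ϑ τ x) := by
  obtain ⟨Zb, hZb⟩ := hZ.2.2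
  have hZc : Continuous Z := hZ.1
  have hZb0 : 0 ≤ Zb := (abs_nonneg _).trans (hZb 0)
  have hM0 : 0 ≤ M := (abs_nonneg _).trans (hB 0).1
  have hN0 : 0 ≤ N := (abs_nonneg _).trans (hN 0).2.1
  obtain ⟨ccont, cmom, cent, crelZ, -, -, cΦ⟩ := h.continuousOn_integrands hG hS htemp hZc
  obtain ⟨cr, cΘ, -, -, cU, -⟩ := h.continuousOn_pointData_base
  obtain ⟨-, -, -, cp, cμ⟩ := h.continuousOn_pointData_thermo hG
  have wM : ∀ i, Continuous fun w : EulerPhase => mom w i := fun i =>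
    (EuclideanSpace.proj i : EuclideanSpace ℝ (Fin 3) →L[ℝ] ℝ).continuous.comp continuous_mom
  have wZS : ContinuousOn (fun w : EulerPhase => Z (eos.s (dens w) (stateTemp eos (dens w) (ien w))))
      phaseQuadrant := hZc.comp_continuousOn (continuousOn_stateEntropy hG hS htemp)
  -- (0) the relative energy itself
  have i0 := slice_integrable hG hS htemp hsupp hτ hC hmom crelZ (A := 2 + 3 * M + N + N * Zb) (B := N)
    (by positivity) hN0 fun x w hw => by
      refine (abs_relEnergyZ_le hw (hB x) hZb (hN x).1 (hN x).2.1).trans ?_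
      have hΦ := momentFun_nonneg (ceos := eos.toConservative) hw
      have : |(pdAt T₁ ρ u ϑ (τ, x)).Θ| * Zb ≤ N * Zb := mul_le_mul_of_nonneg_right (hN x).2.2 hZb0
      nlinarith
  -- (1) kinetic + internal energy
  have c1 : ContinuousOn (fun q : (ℝ × UnitAddTorus (Fin 3)) × EulerPhase => kineticEnergy q.2 + ien q.2)
      (goodSet T₁) := (liftW continuousOn_kineticEnergy).add (liftW continuous_ien.continuousOn)
  have i1 := slice_integrable hG hS htemp hsupp hτ hC hmom c1 (A := 2) (B := 0) (by norm_num) le_rfl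
    fun x w hw => by
      have h1 := kineticEnergy_le_momentFun (ceos := eos.toConservative) hw
      have h2 := ien_le_momentFun (ceos := eos.toConservative) hw
      rw [abs_of_nonneg (add_nonneg (kineticEnergy_nonneg hw.1.le) hw.2.le)]
      linarith
  -- (2) momentum against `U`
  have c2 : ContinuousOn (fun q : (ℝ × UnitAddTorus (Fin 3)) × EulerPhase =>
      ∑ i, mom q.2 i * (pdAt T₁ ρ u ϑ q.1).U i) (goodSet T₁) :=
    continuousOn_finsetSum _ fun i _ => (liftW (wM i).continuousOn).mul (liftZ (cU i))
  have i2 := slice_integrable hG hS htemp hsupp hτ hC hmom c2 (A := 3 * M) (B := 0) (by positivity) le_rfl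
    fun x w hw => by
      have : ∑ i, mom w i * (pdAt T₁ ρ u ϑ (τ, x)).U i = ∑ i, (pdAt T₁ ρ u ϑ (τ, x)).U i * mom w i :=
        Finset.sum_congr rfl fun i _ => mul_comm _ _
      rw [this, add_zero]
      calc |∑ i, (pdAt T₁ ρ u ϑ (τ, x)).U i * mom w i| ≤ M * ∑ i, |mom w i| :=
            abs_sum_mul_le Finset.univ fun i _ => (hB x).2.2.1 i
        _ ≤ M * (3 * momentFun eos.toConservative w) := mul_le_mul_of_nonneg_left (sum_abs_mom_le hw) hM0
        _ = 3 * M * momentFun eos.toConservative w := by ring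
  -- (3) density against `φ₁`
  have c3 : ContinuousOn (fun q : (ℝ × UnitAddTorus (Fin 3)) × EulerPhase =>
      dens q.2 * (‖(pdAt T₁ ρ u ϑ q.1).U‖ ^ 2 / 2 -
        eos.chemPotential (pdAt T₁ ρ u ϑ q.1).r (pdAt T₁ ρ u ϑ q.1).Θ)) (goodSet T₁) := by
    have hU : ContinuousOn (fun z : ℝ × UnitAddTorus (Fin 3) => (pdAt T₁ ρ u ϑ z).U) (Ioo 0 T₁ ×ˢ univ) :=
      h.smooth_velocity.continuousOn_uncurry_Ioo
    exact (liftW continuous_dens.continuousOn).mul (liftZ (((hU.norm.pow 2).div_const 2).sub cμ))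
  have i3 := slice_integrable hG hS htemp hsupp hτ hC hmom c3 (A := N) (B := 0) hN0 le_rfl
    fun x w hw => by
      rw [abs_mul, abs_of_pos hw.1, add_zero, mul_comm]
      exact mul_le_mul (hN x).1 (dens_le_momentFun hw) hw.1.le hN0
  -- (4) `Θ ρ Z(s)`
  have c4 : ContinuousOn (fun q : (ℝ × UnitAddTorus (Fin 3)) × EulerPhase =>
      dens q.2 * Z (eos.s (dens q.2) (stateTemp eos (dens q.2) (ien q.2))) * (pdAt T₁ ρ u ϑ q.1).Θ)
      (goodSet T₁) := ((liftW continuous_dens.continuousOn).mul (liftW wZS)).mul (liftZ cΘ)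
  have i4 := slice_integrable hG hS htemp hsupp hτ hC hmom c4 (A := Zb * N) (B := 0) (by positivity) le_rfl
    fun x w hw => by
      rw [abs_mul, abs_mul, abs_of_pos hw.1, add_zero]
      have hΦ := momentFun_nonneg (ceos := eos.toConservative) hw
      calc dens w * |Z (eos.s (dens w) (stateTemp eos (dens w) (ien w)))| * |(pdAt T₁ ρ u ϑ (τ, x)).Θ|
          ≤ momentFun eos.toConservative w * Zb * N :=
            mul_le_mul (mul_le_mul (dens_le_momentFun hw) (hZb _) (abs_nonneg _) hΦ) (hN x).2.2
              (abs_nonneg _) (by positivity)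
        _ = Zb * N * momentFun eos.toConservative w := by ring
  -- (5) the pressure of the strong solution
  have i5 : Integrable (fun x => eos.p (ρ τ x) (ϑ τ x)) volume := by
    obtain ⟨hρ1, hϑ1, -, -⟩ := h.isContDiff_slices (Ioo_subset_Ico_self hτ)
    have hpos : ∀ y, (ρ τ y, ϑ τ y) ∈ Ioi (0 : ℝ) ×ˢ Ioi (0 : ℝ) := fun y =>
      ⟨h.density_pos τ (Ioo_subset_Ico_self hτ) y, h.temperature_pos τ (Ioo_subset_Ico_self hτ) y⟩
    exact (isContDiff_comp₂ hG.1 le_rfl hρ1 hϑ1 hpos).continuous.integrable_of_hasCompactSupport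
      (HasCompactSupport.of_compactSpace _)
  -- pointwise identity for a.e. `x`
  have hae : ∀ᵐ x ∂(volume : Measure (UnitAddTorus (Fin 3))),
      ∫ w, (pdAt T₁ ρ u ϑ (τ, x)).relEnergyZ eos Z w ∂(Y (τ, x)) =
        (∫ w, kineticEnergy w + ien w ∂(Y (τ, x))) - ⟪∫ w, mom w ∂(Y (τ, x)), u τ x⟫_ℝ +
          (∫ w, dens w ∂(Y (τ, x))) * energyTestFunction eos ρ u ϑ τ x -
            (∫ w, dens w * Z (eos.s (dens w) (stateTemp eos (dens w) (ien w))) ∂(Y (τ, x))) * ϑ τ x +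
              eos.p (ρ τ x) (ϑ τ x) := by
    filter_upwards [ae_slice_moment_lt_top hG hS htemp hsupp hC hmom] with x hx
    haveI : IsProbabilityMeasure (Y (τ, x)) := IsMarkovKernel.isProbabilityMeasure (τ, x)
    obtain ⟨-, hd, hm, hmi, hk, he, -, -, hρZ, -⟩ :=
      integrable_basic_of_moment hG hS htemp (μ := Y (τ, x)) (hsupp (τ, x)) hx.ne hZc hZb
    exact integral_relEnergyZ_eq Z (pdAt T₁ ρ u ϑ (τ, x)) hk he hd hm hmi hρZ
  -- the momentum term in bracket form, a.e. in `x`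
  have hae2 : ∀ᵐ x ∂(volume : Measure (UnitAddTorus (Fin 3))),
      ⟪Young.vavg Y mom τ x, u τ x⟫_ℝ = ∫ w, ∑ i, mom w i * (pdAt T₁ ρ u ϑ (τ, x)).U i ∂(Y (τ, x)) := by
    filter_upwards [ae_slice_moment_lt_top hG hS htemp hsupp hC hmom] with x hx
    haveI : IsProbabilityMeasure (Y (τ, x)) := IsMarkovKernel.isProbabilityMeasure (τ, x)
    obtain ⟨-, -, hm, -⟩ :=
      integrable_basic_of_moment hG hS htemp (μ := Y (τ, x)) (hsupp (τ, x)) hx.ne hZc hZb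
    simp only [Young.vavg]
    rw [real_inner_comm, ← integral_inner hm]
    refine integral_congr_ae (Eventually.of_forall fun w => ?_)
    beta_reduce
    rw [inner_eq_sum']
    rfl
  have i2' : Integrable (fun x => ⟪Young.vavg Y mom τ x, u τ x⟫_ℝ) volume :=
    i2.2.1.congr (hae2.mono fun x hx => hx.symm)
  have e3 : (fun x => Young.avg Y dens τ x * energyTestFunction eos ρ u ϑ τ x) =
      fun x => ∫ w, dens w * (‖(pdAt T₁ ρ u ϑ (τ, x)).U‖ ^ 2 / 2 -
        eos.chemPotential (pdAt T₁ ρ u ϑ (τ, x)).r (pdAt T₁ ρ u ϑ (τ, x)).Θ) ∂(Y (τ, x)) := by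
    funext x
    simp only [Young.avg]
    rw [integral_mul_const]
    rfl
  have e4 : (fun x => Young.avg Y (fun w => dens w * Z (eos.toConservative.entropy (dens w) (ien w))) τ x *
      ϑ τ x) = fun x => ∫ w, dens w * Z (eos.s (dens w) (stateTemp eos (dens w) (ien w))) *
        (pdAt T₁ ρ u ϑ (τ, x)).Θ ∂(Y (τ, x)) := by
    funext x
    simp only [Young.avg]
    rw [integral_mul_const]
    rfl
  have i3' : Integrable (fun x => Young.avg Y dens τ x * energyTestFunction eos ρ u ϑ τ x) volume := by
    rw [e3]; exact i3.2.1
  have i4' : Integrable (fun x => Young.avg Y (fun w => dens w * Z (eos.toConservative.entropy (dens w) (ien w)))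
      τ x * ϑ τ x) volume := by
    rw [e4]; exact i4.2.1
  refine ⟨i0.2.1, i1.2.1, i2', i3', i4', i5, ?_⟩
  -- integrate the pointwise identity
  rw [integral_congr_ae hae]
  have j2 : Integrable (fun x => ⟪∫ w, mom w ∂(Y (τ, x)), u τ x⟫_ℝ) volume := i2'
  have j3 : Integrable (fun x => (∫ w, dens w ∂(Y (τ, x))) * energyTestFunction eos ρ u ϑ τ x) volume := i3'
  have j4 : Integrable (fun x => (∫ w, dens w * Z (eos.s (dens w) (stateTemp eos (dens w) (ien w))) ∂(Y (τ, x))) *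
      ϑ τ x) volume := i4'
  have j1 : Integrable (fun x => ∫ w, kineticEnergy w + ien w ∂(Y (τ, x))) volume := i1.2.1
  rw [integral_add (((j1.sub' j2).fun_add j3).sub' j4) i5, integral_sub ((j1.sub' j2).fun_add j3) j4,
    integral_add (j1.sub' j2) j3, integral_sub j1 j2]
  rfl

/-! ## The initial time: Dirac data -/

/-- The relative energy with cut-off at the state of the strong solution itself:
`ℰ_Z(d | (r, r e(r,Θ), rU)) = Θ r (s(r,Θ) - Z(s(r,Θ)))`. [cite: BrezinaFeireisl2018, §3.2.1] -/
theorem relEnergyZ_classicalState (Z : ℝ → ℝ) (d : StrongPointData) (hr : 0 < d.r) (hΘ : 0 < d.Θ) :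
    d.relEnergyZ eos Z (d.r, d.r * eos.e d.r d.Θ, d.r • d.U) =
      d.Θ * d.r * (eos.s d.r d.Θ - Z (eos.s d.r d.Θ)) := by
  have hT : stateTemp eos d.r (d.r * eos.e d.r d.Θ) = d.Θ := eos.temperature_energy d.r d.Θ hr hΘ
  have hdens : dens (d.r, d.r * eos.e d.r d.Θ, d.r • d.U) = d.r := rfl
  have hien : ien (d.r, d.r * eos.e d.r d.Θ, d.r • d.U) = d.r * eos.e d.r d.Θ := rfl
  have hmom : mom (d.r, d.r * eos.e d.r d.Θ, d.r • d.U) = d.r • d.U := rfl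
  rw [relEnergyZ_eq Z d hr.ne' (by rw [hdens]; exact hr) (by rw [hdens, hien, hT])]
  rw [hdens, hien, hmom, hT]
  have hfull : relEnergyFull eos d d.r (d.r * eos.e d.r d.Θ) (d.r • d.U) = 0 := by
    unfold relEnergyFull
    rw [hT, relEnergyThermo_self]
    simp
  rw [hfull, zero_add]

/-- **The initial terms vanish**: with Dirac initial data `Y_{0,x} = δ_{(r, r e, rU)(0,x)}` and a
cut-off with `Z(s(r,Θ)(0,·)) = s(r,Θ)(0,·)`, the signed combination of the initial terms of the
four DMV identities and `∫ p(r,Θ)(0)` is zero. [cite: BrezinaFeireisl2018, §3.2.1] -/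
theorem initial_terms_eq_zero (h : IsClassicalEulerSolution eos T₁ ρ u ϑ) (hG : eos.IsGibbs) (hT₁ : 0 < T₁)
    (hY0 : ∀ᵐ x ∂(volume : Measure (UnitAddTorus (Fin 3))),
      Y (0, x) = Measure.dirac (classicalState eos ρ u ϑ 0 x))
    {Z : ℝ → ℝ} (hZc : Continuous Z) (hZs : ∀ x, Z (eos.s (ρ 0 x) (ϑ 0 x)) = eos.s (ρ 0 x) (ϑ 0 x))
    (Ψ : TestTriple eos T T₁ ρ u ϑ) (hT : 0 ≤ T) :
    (∫ x, Young.avg Y (fun w => kineticEnergy w + ien w) 0 x) -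
        (∫ x, ⟪Young.vavg Y mom 0 x, Ψ.ψ₂ 0 x⟫_ℝ) +
        (∫ x, Young.avg Y dens 0 x * Ψ.ψ₁ 0 x) -
        (∫ x, Young.avg Y (fun w => dens w * Z (eos.toConservative.entropy (dens w) (ien w))) 0 x *
          Ψ.ψ₃ 0 x) +
        ∫ x, eos.p (ρ 0 x) (ϑ 0 x) = 0 := by
  have h0 : (0 : ℝ) ∈ Ico 0 T₁ := ⟨le_rfl, hT₁⟩
  have h0' : (0 : ℝ) ∈ Icc 0 Ψ.T' := ⟨le_rfl, hT.trans Ψ.hT.le⟩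
  obtain ⟨hρ1, hϑ1, hu1, hui⟩ := h.isContDiff_slices h0
  have hpos : ∀ y, (ρ 0 y, ϑ 0 y) ∈ Ioi (0 : ℝ) ×ˢ Ioi (0 : ℝ) := fun y =>
    ⟨h.density_pos 0 h0 y, h.temperature_pos 0 h0 y⟩
  set c₀ : UnitAddTorus (Fin 3) → EulerPhase := classicalState eos ρ u ϑ 0 with hc₀
  have hs0 : ∀ x, eos.toConservative.entropy (dens (c₀ x)) (ien (c₀ x)) = eos.s (ρ 0 x) (ϑ 0 x) := by
    intro x
    show eos.s (ρ 0 x) (eos.temperature (ρ 0 x) (ρ 0 x * eos.e (ρ 0 x) (ϑ 0 x))) = _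
    rw [eos.temperature_energy _ _ (hpos x).1 (hpos x).2]
  -- the five integrands as continuous functions of `x`
  have e1 : ∀ᵐ x ∂(volume : Measure (UnitAddTorus (Fin 3))),
      Young.avg Y (fun w => kineticEnergy w + ien w) 0 x = kineticEnergy (c₀ x) + ien (c₀ x) := by
    filter_upwards [hY0] with x hx
    simp only [Young.avg, hx, integral_dirac]
  have e2 : ∀ᵐ x ∂(volume : Measure (UnitAddTorus (Fin 3))),
      ⟪Young.vavg Y mom 0 x, Ψ.ψ₂ 0 x⟫_ℝ = ⟪mom (c₀ x), u 0 x⟫_ℝ := by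
    filter_upwards [hY0] with x hx
    simp only [Young.vavg, hx, integral_dirac, Ψ.eq₂ 0 h0' x]
  have e3 : ∀ᵐ x ∂(volume : Measure (UnitAddTorus (Fin 3))),
      Young.avg Y dens 0 x * Ψ.ψ₁ 0 x = dens (c₀ x) * energyTestFunction eos ρ u ϑ 0 x := by
    filter_upwards [hY0] with x hx
    simp only [Young.avg, hx, integral_dirac, Ψ.eq₁ 0 h0' x]
  have e4 : ∀ᵐ x ∂(volume : Measure (UnitAddTorus (Fin 3))),
      Young.avg Y (fun w => dens w * Z (eos.toConservative.entropy (dens w) (ien w))) 0 x * Ψ.ψ₃ 0 x =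
        dens (c₀ x) * Z (eos.s (ρ 0 x) (ϑ 0 x)) * ϑ 0 x := by
    filter_upwards [hY0] with x hx
    simp only [Young.avg, hx, integral_dirac, Ψ.eq₃ 0 h0' x, hs0 x]
  rw [integral_congr_ae e1, integral_congr_ae e2, integral_congr_ae e3, integral_congr_ae e4]
  -- continuity, hence integrability, of the explicit integrands
  have cρ : Continuous (ρ 0) := hρ1.continuous
  have cϑ : Continuous (ϑ 0) := hϑ1.continuous
  have cu : Continuous (u 0) := hu1.continuous
  have ce : Continuous fun y => eos.e (ρ 0 y) (ϑ 0 y) := (isContDiff_comp₂ hG.2.1 le_rfl hρ1 hϑ1 hpos).continuous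
  have cs : Continuous fun y => eos.s (ρ 0 y) (ϑ 0 y) := (isContDiff_comp₂ hG.2.2.1 le_rfl hρ1 hϑ1 hpos).continuous
  have cp : Continuous fun y => eos.p (ρ 0 y) (ϑ 0 y) := (isContDiff_comp₂ hG.1 le_rfl hρ1 hϑ1 hpos).continuous
  have cμ : Continuous fun y => eos.chemPotential (ρ 0 y) (ϑ 0 y) := by
    unfold EulerEOS.chemPotential
    exact (ce.sub (cϑ.mul cs)).add (cp.div cρ fun y => (hpos y).1.ne')
  have cdens : Continuous fun x => dens (c₀ x) := cρ
  have cien : Continuous fun x => ien (c₀ x) := cρ.mul ce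
  have cmom : Continuous fun x => mom (c₀ x) := cρ.smul cu
  have ckin : Continuous fun x => kineticEnergy (c₀ x) := by
    unfold kineticEnergy
    exact (cmom.norm.pow 2).div (continuous_const.mul cdens) fun x => by
      have hx : 0 < ρ 0 x := (hpos x).1
      show 2 * ρ 0 x ≠ 0
      positivity
  have cφ : Continuous fun x => energyTestFunction eos ρ u ϑ 0 x := by
    unfold energyTestFunction
    exact ((cu.norm.pow 2).div_const 2).sub cμ
  have int : ∀ {f : UnitAddTorus (Fin 3) → ℝ}, Continuous f → Integrable f volume := fun hf =>
    hf.integrable_of_hasCompactSupport (HasCompactSupport.of_compactSpace _)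
  have j1 : Integrable (fun x => kineticEnergy (c₀ x) + ien (c₀ x)) volume := int (ckin.add cien)
  have j2 : Integrable (fun x => ⟪mom (c₀ x), u 0 x⟫_ℝ) volume := int (cmom.inner cu)
  have j3 : Integrable (fun x => dens (c₀ x) * energyTestFunction eos ρ u ϑ 0 x) volume := int (cdens.mul cφ)
  have j4 : Integrable (fun x => dens (c₀ x) * Z (eos.s (ρ 0 x) (ϑ 0 x)) * ϑ 0 x) volume :=
    int ((cdens.mul (hZc.comp cs)).mul cϑ)
  have j5 : Integrable (fun x => eos.p (ρ 0 x) (ϑ 0 x)) volume := int cp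
  rw [← integral_sub j1 j2, ← integral_add (j1.sub' j2) j3, ← integral_sub ((j1.sub' j2).fun_add j3) j4,
    ← integral_add (((j1.sub' j2).fun_add j3).sub' j4) j5]
  refine integral_eq_zero_of_ae (Eventually.of_forall fun x => ?_)
  have hval := relEnergyZ_classicalState (eos := eos) Z (pdAt T₁ ρ u ϑ (0, x)) (hpos x).1 (hpos x).2
  have hc₀x : c₀ x = ((pdAt T₁ ρ u ϑ (0, x)).r, (pdAt T₁ ρ u ϑ (0, x)).r *
      eos.e (pdAt T₁ ρ u ϑ (0, x)).r (pdAt T₁ ρ u ϑ (0, x)).Θ,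
      (pdAt T₁ ρ u ϑ (0, x)).r • (pdAt T₁ ρ u ϑ (0, x)).U) := rfl
  have key : kineticEnergy (c₀ x) + ien (c₀ x) - ⟪mom (c₀ x), u 0 x⟫_ℝ +
      dens (c₀ x) * energyTestFunction eos ρ u ϑ 0 x -
        dens (c₀ x) * Z (eos.s (ρ 0 x) (ϑ 0 x)) * ϑ 0 x + eos.p (ρ 0 x) (ϑ 0 x) =
      (pdAt T₁ ρ u ϑ (0, x)).relEnergyZ eos Z (c₀ x) := by
    rw [hc₀x]
    simp only [relEnergyZ, energyTestFunction, inner_eq_sum']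
    have hT0 : stateTemp eos (dens ((pdAt T₁ ρ u ϑ (0, x)).r, (pdAt T₁ ρ u ϑ (0, x)).r *
        eos.e (pdAt T₁ ρ u ϑ (0, x)).r (pdAt T₁ ρ u ϑ (0, x)).Θ,
        (pdAt T₁ ρ u ϑ (0, x)).r • (pdAt T₁ ρ u ϑ (0, x)).U))
        (ien ((pdAt T₁ ρ u ϑ (0, x)).r, (pdAt T₁ ρ u ϑ (0, x)).r *
        eos.e (pdAt T₁ ρ u ϑ (0, x)).r (pdAt T₁ ρ u ϑ (0, x)).Θ,
        (pdAt T₁ ρ u ϑ (0, x)).r • (pdAt T₁ ρ u ϑ (0, x)).U)) = ϑ 0 x :=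
      eos.temperature_energy _ _ (hpos x).1 (hpos x).2
    rw [hT0]
    simp only [dens, ien, mom, pdAt, classicalPointData, Fin.sum_univ_three]
    ring
  beta_reduce
  rw [Pi.zero_apply, key, hc₀x, hval]
  simp only [pdAt, classicalPointData, hZs x, sub_self, mul_zero]

/-! ## The concentration term -/

/-- **Bound on the concentration pairing**: if `|∂ⱼ(φ)ᵢ| ≤ M` on `[0,τ) × 𝕋³` then
`|∫_{[0,τ)×𝕋³} ∇φ : dμ_R| ≤ M · massUpTo τ`. [cite: BrezinaFeireisl2018, (2.29), §3.1.1] -/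
theorem abs_pairGrad_le (μR : ConcentrationMeasure) {τ : ℝ}
    {φ : ℝ → UnitAddTorus (Fin 3) → EuclideanSpace ℝ (Fin 3)} {M : ℝ}
    (hM : ∀ z ∈ Ico (0 : ℝ) τ ×ˢ (univ : Set (UnitAddTorus (Fin 3))), ∀ i j,
      |partialDeriv j (fun y => φ z.1 y i) z.2| ≤ M) :
    |μR.pairGrad τ φ| ≤ M * (μR.massUpTo τ).toReal := by
  haveI := μR.pos_finite
  haveI := μR.neg_finite
  set A := Ico (0 : ℝ) τ ×ˢ (univ : Set (UnitAddTorus (Fin 3))) with hA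
  have hb : ∀ i j (ν : Measure (ℝ × UnitAddTorus (Fin 3))) [IsFiniteMeasure ν],
      |∫ z in A, partialDeriv j (fun y => φ z.1 y i) z.2 ∂ν| ≤ M * ν.real A := by
    intro i j ν _
    rw [← Real.norm_eq_abs]
    exact norm_setIntegral_le_of_norm_le_const (measure_lt_top ν A) fun z hz => by
      rw [Real.norm_eq_abs]; exact hM z hz i j
  unfold ConcentrationMeasure.pairGrad ConcentrationMeasure.massUpTo
  rw [ENNReal.toReal_sum fun i _ => ENNReal.sum_ne_top.2 fun j _ =>
    ENNReal.add_ne_top.2 ⟨measure_ne_top _ _, measure_ne_top _ _⟩, Finset.mul_sum]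
  refine (Finset.abs_sum_le_sum_abs _ _).trans (Finset.sum_le_sum fun i _ => ?_)
  rw [ENNReal.toReal_sum fun j _ => ENNReal.add_ne_top.2 ⟨measure_ne_top _ _, measure_ne_top _ _⟩,
    Finset.mul_sum]
  refine (Finset.abs_sum_le_sum_abs _ _).trans (Finset.sum_le_sum fun j _ => ?_)
  rw [ENNReal.toReal_add (measure_ne_top _ _) (measure_ne_top _ _), mul_add]
  have h1 := hb i j (μR.pos i j)
  have h2 := hb i j (μR.neg i j)
  calc _ ≤ |∫ z in A, partialDeriv j (fun y => φ z.1 y i) z.2 ∂(μR.pos i j)| +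
      |∫ z in A, partialDeriv j (fun y => φ z.1 y i) z.2 ∂(μR.neg i j)| := abs_sub _ _
    _ ≤ _ := add_le_add h1 h2

end CompressibleEuler

end Literature.Analysis.FluidPDE
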